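import Mathlib

/-!
# Automorphisms of `N ⋊ ℤ` for a perfect group `N`

Solo unit `solo-SmoothPoincare4-informed`, session 9 (HOME `paper/miyazawa-spheres.md`, Thm 9.5 and
its odd-twist companion Thm 9.5′, Step 1).  For the mapping torus `Y ×_ι S¹` of the covering
involution `ι` of `Y = Σ(2,q,r)` one has `π₁ = Γ̃ ⋊_θ ℤ` with `Γ̃ = π₁ Y` perfect.  The general
facts proved here, for any perfect group `N` and any action `φ` of `ℤ` on `N`:

* the commutator subgroup of `N ⋊[φ] ℤ` is exactly `N` (the kernel of the projection to `ℤ`);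
* every automorphism of `N ⋊[φ] ℤ` maps `N` into `N`;
* every automorphism induces `± id` on the quotient `ℤ`.

(`ℤ` is written multiplicatively as `Multiplicative ℤ`; the product case `φ = 1` is the file
`SoloInformedProductAutomorphism`.)
-/

namespace Summit.SmoothPoincare4.SmoothPoincare4.Theorems
namespace PerfectSemidirect

open Subgroup Multiplicative SemidirectProduct

variable {N : Type*} [Group N] (φ : Multiplicative ℤ →* MulAut N)

/-- `inl` maps the commutator subgroup of `N` into the commutator subgroup of `N ⋊ ℤ`. -/
theorem map_inl_commutator_le :
    (commutator N).map (inl : N →* N ⋊[φ] Multiplicative ℤ) ≤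
      commutator (N ⋊[φ] Multiplicative ℤ) := by
  rw [commutator_def, commutator_def, Subgroup.map_commutator]
  exact Subgroup.commutator_mono le_top le_top

/-- For `N` perfect, the commutator subgroup of `N ⋊[φ] ℤ` is the kernel of the projection
to `ℤ`, i.e. the copy of `N`. -/
theorem commutator_eq_ker_rightHom (hN : commutator N = ⊤) :
    commutator (N ⋊[φ] Multiplicative ℤ) =
      (rightHom : N ⋊[φ] Multiplicative ℤ →* Multiplicative ℤ).ker := by
  apply le_antisymm
  · exact Abelianization.commutator_subset_ker _
  · intro x hx
    rw [MonoidHom.mem_ker, rightHom_eq_right] at hx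
    have hx' : x = inl x.left := by
      ext <;> simp [hx]
    have hmem : x.left ∈ commutator N := by rw [hN]; exact Subgroup.mem_top _
    rw [hx']
    exact map_inl_commutator_le φ (Subgroup.mem_map_of_mem _ hmem)

variable {φ}

/-- For `N` perfect, every automorphism of `N ⋊[φ] ℤ` maps the normal subgroup `N` into
itself: the `ℤ`-coordinate of the image of `(n, 0)` vanishes. -/
theorem right_mulEquiv_apply_inl (hN : commutator N = ⊤)
    (α : (N ⋊[φ] Multiplicative ℤ) ≃* (N ⋊[φ] Multiplicative ℤ)) (n : N) :
    (α (inl n)).right = 1 := by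
  have hmem : (inl n : N ⋊[φ] Multiplicative ℤ) ∈ commutator (N ⋊[φ] Multiplicative ℤ) := by
    have : n ∈ commutator N := by rw [hN]; exact Subgroup.mem_top _
    exact map_inl_commutator_le φ (Subgroup.mem_map_of_mem _ this)
  have hchar : (commutator (N ⋊[φ] Multiplicative ℤ)).map α.toMonoidHom =
      commutator (N ⋊[φ] Multiplicative ℤ) :=
    (Subgroup.characteristic_iff_map_eq.mp inferInstance) α
  have h2 : α (inl n) ∈ commutator (N ⋊[φ] Multiplicative ℤ) := by
    rw [← hchar]
    exact Subgroup.mem_map_of_mem α.toMonoidHom hmem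
  rw [commutator_eq_ker_rightHom φ hN, MonoidHom.mem_ker, rightHom_eq_right] at h2
  exact h2

/-- For `N` perfect, every automorphism of `N ⋊[φ] ℤ` induces `± id` on the quotient `ℤ`:
the `ℤ`-coordinate of the image of the generator `(1, 1)` is `1` or `-1`. -/
theorem toAdd_right_mulEquiv_apply_inr (hN : commutator N = ⊤)
    (α : (N ⋊[φ] Multiplicative ℤ) ≃* (N ⋊[φ] Multiplicative ℤ)) :
    toAdd (α (inr (ofAdd (1 : ℤ)))).right = 1 ∨
      toAdd (α (inr (ofAdd (1 : ℤ)))).right = -1 := by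
  set ψ : Multiplicative ℤ →* Multiplicative ℤ :=
    (rightHom : N ⋊[φ] Multiplicative ℤ →* Multiplicative ℤ).comp
      (α.toMonoidHom.comp (inr : Multiplicative ℤ →* N ⋊[φ] Multiplicative ℤ)) with hψ
  have hψ1 : ψ (ofAdd 1) = (α (inr (ofAdd (1 : ℤ)))).right := by
    simp [hψ]
  obtain ⟨y, hy⟩ := α.surjective (inr (ofAdd (1 : ℤ)))
  have hysplit : y = inl y.left * inr y.right := (inl_left_mul_inr_right y).symm
  have hright : (α y).right = (α (inr y.right)).right := by
    rw [hysplit, map_mul, mul_right, right_mulEquiv_apply_inl hN α y.left]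
    simp
  have hαinr : (α (inr y.right)).right = ψ y.right := by simp [hψ]
  have hpow : ψ y.right = ψ (ofAdd 1) ^ (toAdd y.right) := by
    conv_lhs => rw [show y.right = ofAdd (1 : ℤ) ^ (toAdd y.right) by
      rw [← ofAdd_zsmul, smul_eq_mul, mul_one, ofAdd_toAdd]]
    exact map_zpow ψ _ _
  have key : ofAdd (1 : ℤ) = (α (inr (ofAdd (1 : ℤ)))).right ^ (toAdd y.right) := by
    have := congrArg SemidirectProduct.right hy
    rw [hright, hαinr, hpow, hψ1, right_inr] at this
    exact this.symm
  set k : ℤ := toAdd (α (inr (ofAdd (1 : ℤ)))).right with hk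
  have hk' : (α (inr (ofAdd (1 : ℤ)))).right = ofAdd k := by rw [hk, ofAdd_toAdd]
  rw [hk', ← ofAdd_zsmul, smul_eq_mul] at key
  have hmul : k * toAdd y.right = 1 := by
    have := congrArg toAdd key
    simpa [mul_comm] using this.symm
  rcases Int.eq_one_or_neg_one_of_mul_eq_one' hmul with ⟨h, _⟩ | ⟨h, _⟩
  · exact Or.inl h
  · exact Or.inr h

end PerfectSemidirect
end Summit.SmoothPoincare4.SmoothPoincare4.Theorems
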